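import Literature.Probability.Percolation.TwoClusterGibbsCovarianceRC
import Literature.Probability.Percolation.TwoClusterGibbsHubCovariance
import HarnessLib

/-!
# Covariances along the two-cluster Gibbs sampler of van den Berg–Häggström–Kahn (2006), §2.1, for the
# random-cluster measure `φ_{𝐩,q}`, `q ≥ 1` — JOINT tests: the one-step decomposition with its cross term, the
# reduction theorem for a test `h(C_S, C_T)` decreasing in the conditioning cluster, and the HUB-TEST form

Topic `Literature/Probability/Percolation`; the `q ≥ 1` companion of `TwoClusterGibbsJointCovariance.lean`,
`TwoClusterGibbsJointCovarianceMeasure.lean` and `TwoClusterGibbsHubCovariance.lean` (the same statements at `q = 1`,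
product measure), built on `TwoClusterGibbsCovarianceRC.lean` (tests of `C_S` only, for `φ_{𝐩,q}`: the operators
`BHK2006.rcCondS`, `BHK2006.rcGibbsT`, their monotonicity for `q ≥ 1` and the Doeblin contraction) and on the
random-cluster two-block sampler of `TwoSetConditionalAssociationRC.lean` (BHK §2.1 for `φ_{𝐩,q}`: Lemmas 2.2–2.4,
the chain, stationarity).  ALL declarations are definitions with bodies or theorems (D-0014/D-0026: no named fact is
introduced).

Written for the FK sub-lane of the `prim` cell's post-continuity programme (run/shared/lean/prim/bschramm/FK-Q2.md
§12.2–12.7): the `q = 1` hub form `BHK2006_multiMarkerHubCov_nonneg_of_within` is the reduction step of the MIXED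
conditioned slack hierarchy / the star estimate `(★^H)` (`…CovTauStarNReal`), whose random-cluster version is the base
case of the lane's Lemma `Δ_N^S` for `φ_{𝐩,q}`.

## The mathematics

`φ = φ_{𝐩,q} = rcMeasureW w q ∅` on a finite vertex type, vertex sets `S, T`, `D = {S ↮ T}`,
`(A φ)(B) = E_{φ_{G − B̄_T, q}}[φ(C_S)]` (`BHK2006.rcCondS`; on `D` the conditional expectation given `C_T = B`,
Lemmas 2.3–2.4), `𝑇` BHK's one-step operator on functions of `C_S` (`BHK2006.rcGibbsT`).  For a function `φ` of
`C_S` and a JOINT test `h(C_S, C_T)` put `cov_D(φ, h) = φ(D)·E[φ h 1_D] − E[φ 1_D]·E[h 1_D]` (`rcCovDST`) and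
`R(φ) = E[ Cov(φ(C_S), h(C_S, C_T) | C_T) ; D ]` (`rcWithinDST`, the test frozen at the conditioning cluster).  The
law of total covariance along `σ(C_T)` and the two half-steps of the chain give the exact ONE-STEP DECOMPOSITION

  `cov_D(φ, h) = φ(D)·( R(φ) + X(φ) ) + cov_D(𝑇φ, h)`        (`BHK2006.rcCovDST_eq_withinDST_add`),

where the CROSS TERM `X(φ) = E[ 1_D · Cov_{η ~ φ_{G − C̄_S, q}}( (Aφ)(C_T(η)), h(C_S, C_T(η)) ) ]` (`rcCrossDST`)
records that the test moves with the resampled conditioning cluster; it vanishes for a test of `C_S` alone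
(`rcCrossDST_const`), recovering `rcCovD_eq_withinD_add`.  For `q ≥ 1`, `(Aφ)(B)` is DECREASING in `B` for
increasing `φ` (display (16) / Remark 2.8) and `C_T(η)` is increasing in `η`, so the FKG inequality of
`φ_{G − C̄_S, q}` (Lemma 2.2) gives `X(φ) ≥ 0` whenever `h(C, ·)` is decreasing for every `C`
(`rcCrossDST_nonneg`).  Hence the REDUCTION THEOREM (`BHK2006.rcCovDST_nonneg_of_withinDST_nonneg`): if `q ≥ 1`, every
non-loop pair meeting `T` has `w e < 1`, `h(C, ·)` is decreasing for every `C`, and `R(g) ≥ 0` for every monotone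
nonnegative `g`, then `cov_D(f, h) ≥ 0` for every monotone `f` — by the telescoped decomposition
(`rcCovDST_eq_sum_withinDST_add`), monotonicity/positivity of the iterates `𝑇ᵏ(f − f ∅)` and the regeneration
contraction.  Measure-level form for `rcMeasureW w q ∅`, one source `s`, an avoided set `X`, worlds
`φ^ω = rcMeasureW (delW w A_X(ω)) q ∅` (`BHK2006_clusterJointTestCov_nonneg_of_within_rc`), and the multi-marker form
with a HUB TEST `1{Σ ↔ s}·1{Σ ↮ X}` entering with a nonnegative coefficient
(`BHK2006_multiMarkerHubCov_nonneg_of_within_rc`).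

Not in print in this form; it is BHK's proof scheme of Thm. 2.1 for the random-cluster measure (§2.1 pp. 10–11)
with the FKG step replaced by an abstract hypothesis on the one-step conditional covariances, the test being
allowed to depend (decreasingly) on the conditioning cluster, derived here exactly as at `q = 1` in
`TwoClusterGibbsJointCovariance.lean`.  Not here: tests increasing in `C_T` (the cross term then has the wrong
sign), several hub tests, negative hub coefficients, the closure over degenerate parameters (the device of
`BHK2006_clusterConditionalCov_nonneg_of_within_rc_of_forall_nondegenerate` applies verbatim if wanted).
[cite: VandenbergHaggstromKahn2005, §2.1 pp. 9–13 (eq. (11), Lemmas 2.2–2.4, the chain, Claim 2.5, display (16), Remark 2.8)]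
[cite: Grimmett2006, §1.4 eq. (1.20) (p. 15); Thm. (3.8) (FKG); Thm. (3.21), eq. (3.22) (comparison inequalities)]

## References

* J. van den Berg, O. Häggström, J. Kahn, *Some conditional correlation inequalities for percolation and
  related processes*, Random Structures Algorithms 29 (2006) 417–435 (arXiv:math/0408176): §2.1, eq. (11),
  Thm. 2.1, Lemmas 2.2–2.4, Claim 2.5, Lemmas 2.6–2.7, display (16), Remark 2.8 (pp. 9–12).
* G. Grimmett, *The Random-Cluster Model*, Springer 2006: eq. (1.20) (p. 15), Thm. (3.8) (FKG),
  Thm. (3.21) eq. (3.22) (comparison inequalities).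
* G. Kozma, N. Nitzan, arXiv:2401.12397, §5.5 Question 9 (p. 36) (the hub-test shape at `q = 1`).
-/

noncomputable section

open MeasureTheory unitInterval
open Literature.Probability.LatticeModels (rcMeasureW isProbabilityMeasure_rcMeasureW)

namespace Literature.Probability.Percolation

namespace BHK2006

open scoped Classical
open DecisionTree (ind ind_of_mem ind_of_not_mem ind_nonneg)

section Helpers

variable {V : Type*} [Fintype V] {w : Sym2 V → unitInterval} {q : ℝ}

/-- `|E[g 1_D]| ≤ c · φ(D)` when `|g| ≤ c` on the configurations (`q > 0`). [folklore] -/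
private theorem abs_sum_rcMass_ind_le (hq : 0 < q) (D : Set (Set (Sym2 V))) {g : Set (Sym2 V) → ℝ}
    {c : ℝ} (hg : ∀ ω, |g ω| ≤ c) :
    |∑ ω, rcMass w q ω * (g ω * ind D ω)| ≤ c * ∑ ω, rcMass w q ω * ind D ω := by
  calc |∑ ω, rcMass w q ω * (g ω * ind D ω)| ≤ ∑ ω, |rcMass w q ω * (g ω * ind D ω)| :=
        Finset.abs_sum_le_sum_abs _ _
    _ ≤ ∑ ω, c * (rcMass w q ω * ind D ω) := Finset.sum_le_sum fun ω _ => by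
        rw [abs_mul, abs_mul, abs_of_nonneg (rcMass_nonneg w hq ω), abs_of_nonneg (ind_nonneg D ω)]
        calc rcMass w q ω * (|g ω| * ind D ω) ≤ rcMass w q ω * (c * ind D ω) :=
              mul_le_mul_of_nonneg_left (mul_le_mul_of_nonneg_right (hg ω) (ind_nonneg D ω))
                (rcMass_nonneg w hq ω)
          _ = c * (rcMass w q ω * ind D ω) := by ring
    _ = c * ∑ ω, rcMass w q ω * ind D ω := by rw [Finset.mul_sum]

variable (w) in
/-- `ε = ∏_{e non-loop, e meets T} (1 − w e) ≤ 1` (a product of numbers in `[0,1]`). [folklore] -/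
private theorem regenWeight_coe_le_one (T : Set V) : regenWeight (fun e => (w e : ℝ)) T ≤ 1 := by
  rw [regenWeight_eq_prod w T]
  exact Finset.prod_le_one (fun e _ => sub_nonneg.2 (w e).2.2)
    fun e _ => sub_le_self _ (w e).2.1

end Helpers

end BHK2006

namespace BHK2006

open scoped Classical
open DecisionTree (ind ind_of_mem ind_of_not_mem ind_nonneg)

section JointSums

variable {V : Type*} [Fintype V] (w : Sym2 V → unitInterval) (q : ℝ) (S T : Set V)

/-- **Conditional covariance given `C_T = B`** of `φ(C_S)` and a JOINT test `h(C_S, C_T)` for `φ_{𝐩,q}`: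
`E[φ(C_S) h(C_S, B) | C_T = B] − E[φ(C_S) | C_T = B]·E[h(C_S, B) | C_T = B]` (the test frozen at the
conditioning cluster `B`; expectations under `φ_{G − B̄_T, q}`). [cite: VandenbergHaggstromKahn2005, §2.1 Lemmas 2.3–2.4 (p. 10)] -/
def rcCondCovST (φ : Set (Sym2 V) → ℝ) (h : Set (Sym2 V) → Set (Sym2 V) → ℝ) (B : Set (Sym2 V)) : ℝ :=
  rcCondS w q S T (fun A => φ A * h A B) B - rcCondS w q S T φ B * rcCondS w q S T (fun A => h A B) B

/-- **The averaged one-step ("within") covariance for a joint test** (`φ_{𝐩,q}`):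
`R(φ) = E[ Cov(φ(C_S), h(C_S, C_T) | C_T) 1_D ]` (denominator-free). [cite: VandenbergHaggstromKahn2005, §2.1 pp. 10–11] -/
def rcWithinDST (D : Set (Set (Sym2 V))) (φ : Set (Sym2 V) → ℝ) (h : Set (Sym2 V) → Set (Sym2 V) → ℝ) : ℝ :=
  ∑ ω, rcMass w q ω * (rcCondCovST w q S T φ h (setCl ω T) * ind D ω)

/-- **Denominator-free conditional covariance on `D`** of `φ(C_S)` and a joint test `h(C_S, C_T)` under
`φ_{𝐩,q}`: `cov_D(φ, h) = φ(D)·E[φ(C_S) h(C_S, C_T) 1_D] − E[φ(C_S) 1_D]·E[h(C_S, C_T) 1_D]`.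
[cite: VandenbergHaggstromKahn2005, Thm. 2.1 eq. (12) (p. 9); Thm. 1.5 eq. (9) (p. 7)] -/
def rcCovDST (D : Set (Set (Sym2 V))) (φ : Set (Sym2 V) → ℝ) (h : Set (Sym2 V) → Set (Sym2 V) → ℝ) : ℝ :=
  (∑ ω, rcMass w q ω * ind D ω) *
      (∑ ω, rcMass w q ω * (φ (setCl ω S) * h (setCl ω S) (setCl ω T) * ind D ω)) -
    (∑ ω, rcMass w q ω * (φ (setCl ω S) * ind D ω)) *
      (∑ ω, rcMass w q ω * (h (setCl ω S) (setCl ω T) * ind D ω))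

/-- **The cross term of the `T`-half-step for a joint test** (`φ_{𝐩,q}`):
`X(φ) = E[ 1_D · Cov_η( (Aφ)(C_T'), h(C_S, C_T') ) ]`, where given `C_S` the new `C_T' = C_T(η)` is the cluster
of `T` in a fresh configuration `η ~ φ_{G − C̄_S, q}` and `(Aφ)(B) = E[φ(C_S) | C_T = B]` — the covariance, over the
fresh configuration, of the (decreasing) conditional mean of `φ` with the test read at the new conditioning
cluster.  It vanishes when `h` does not depend on `C_T`.
[cite: VandenbergHaggstromKahn2005, §2.1 pp. 10–12 (the chain; Remark 2.8: "`C_T^n` is decreasing")] -/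
def rcCrossDST (D : Set (Set (Sym2 V))) (φ : Set (Sym2 V) → ℝ) (h : Set (Sym2 V) → Set (Sym2 V) → ℝ) : ℝ :=
  ∑ ω, rcMass w q ω *
    (((∑ η, rcMass (delW w (barOf S (setCl ω S))) q η *
          (rcCondS w q S T φ (setCl η T) * h (setCl ω S) (setCl η T))) -
        rcGibbsT w q S T φ (setCl ω S) *
          (∑ η, rcMass (delW w (barOf S (setCl ω S))) q η * h (setCl ω S) (setCl η T))) * ind D ω)

/-- For a test not depending on `C_T` the joint quantities are the one-cluster ones:
`rcCondCovST (h ∘ fst) = rcCondCov h`. [cite: VandenbergHaggstromKahn2005, §2.1 Lemma 2.4 (p. 10) — bookkeeping, derived here] -/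
theorem rcCondCovST_const (φ h : Set (Sym2 V) → ℝ) (B : Set (Sym2 V)) :
    rcCondCovST w q S T φ (fun A _ => h A) B = rcCondCov w q S T φ h B := rfl

/-- `rcCovDST (h ∘ fst) = rcCovD h`. [cite: VandenbergHaggstromKahn2005, Thm. 1.5 eq. (9) (p. 7) — bookkeeping, derived here] -/
theorem rcCovDST_const (D : Set (Set (Sym2 V))) (φ h : Set (Sym2 V) → ℝ) :
    rcCovDST w q S T D φ (fun A _ => h A) = rcCovD w q S D φ h := rfl

/-- `X(φ) = 0` for a test not depending on `C_T` (`q > 0`; then the one-step decomposition is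
`rcCovD_eq_withinD_add`). [cite: VandenbergHaggstromKahn2005, §2.1 pp. 10–11 (the chain) — corollary, derived here] -/
theorem rcCrossDST_const (hq : 0 < q) (D : Set (Set (Sym2 V))) (φ h : Set (Sym2 V) → ℝ) :
    rcCrossDST w q S T D φ (fun A _ => h A) = 0 := by
  refine Finset.sum_eq_zero fun ω _ => ?_
  have e1 : ∑ η, rcMass (delW w (barOf S (setCl ω S))) q η *
      (rcCondS w q S T φ (setCl η T) * h (setCl ω S)) = rcGibbsT w q S T φ (setCl ω S) * h (setCl ω S) := by
    rw [rcGibbsT, Finset.sum_mul]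
    exact Finset.sum_congr rfl fun η _ => by ring
  have e2 : ∑ η, rcMass (delW w (barOf S (setCl ω S))) q η * h (setCl ω S) = h (setCl ω S) := by
    rw [← Finset.sum_mul, sum_rcMass _ hq, one_mul]
  rw [e1, e2, sub_self, zero_mul, mul_zero]

/-! ### The one-step decomposition with the cross term -/

/-- **One-step covariance decomposition along BHK's chain for `φ_{𝐩,q}`, joint test**: for any function `φ` of
`C_S` and any joint test `h` of `(C_S, C_T)` (`q > 0`),
`cov_D(φ, h) = φ(D)·(R(φ) + X(φ)) + cov_D(𝑇φ, h)` — an exact identity (law of total covariance along `σ(C_T)`,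
then the `T`-half-step, which for a test depending on `C_T` leaves the cross covariance `X(φ)`).
[cite: VandenbergHaggstromKahn2005, §2.1 Lemmas 2.3–2.4 (p. 10) and pp. 10–11 (the chain) — corollary, derived here] -/
theorem rcCovDST_eq_withinDST_add (hq : 0 < q) {D : Set (Set (Sym2 V))}
    (hD : ∀ ω, ω ∈ D ↔ ∀ s ∈ S, ∀ t ∈ T, ¬ (openGraph ω).Reachable s t)
    (φ : Set (Sym2 V) → ℝ) (h : Set (Sym2 V) → Set (Sym2 V) → ℝ) :
    rcCovDST w q S T D φ h =
      (∑ ω, rcMass w q ω * ind D ω) * (rcWithinDST w q S T D φ h + rcCrossDST w q S T D φ h) +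
        rcCovDST w q S T D (rcGibbsT w q S T φ) h := by
  -- (e1)–(e3): `E[ψ(C_S, C_T) 1_D] = E[(A ψ(·, C_T))(C_T) 1_D]` for `ψ = φh, φ, h` (the `S`-half-step)
  have e1 : ∑ ω, rcMass w q ω * (φ (setCl ω S) * h (setCl ω S) (setCl ω T) * ind D ω) =
      ∑ ω, rcMass w q ω *
        (rcCondS w q S T (fun A => φ A * h A (setCl ω T)) (setCl ω T) * ind D ω) :=
    rc_set_sum_cond_cluster' w hq S T (fun A B => φ A * h A B) hD
  have e2 : ∑ ω, rcMass w q ω * (φ (setCl ω S) * ind D ω) =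
      ∑ ω, rcMass w q ω * (rcCondS w q S T φ (setCl ω T) * ind D ω) :=
    rc_set_sum_cond_cluster' w hq S T (fun A _ => φ A) hD
  have e3 : ∑ ω, rcMass w q ω * (h (setCl ω S) (setCl ω T) * ind D ω) =
      ∑ ω, rcMass w q ω * (rcCondS w q S T (fun A => h A (setCl ω T)) (setCl ω T) * ind D ω) :=
    rc_set_sum_cond_cluster' w hq S T (fun A B => h A B) hD
  -- (e5): `E[(Aφ)(C_T) (A h(·,C_T))(C_T) 1_D] = E[(Aφ)(C_T) h(C_S, C_T) 1_D]` (the `S`-half-step backwards)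
  have e5 : ∑ ω, rcMass w q ω * (rcCondS w q S T φ (setCl ω T) * h (setCl ω S) (setCl ω T) * ind D ω) =
      ∑ ω, rcMass w q ω * (rcCondS w q S T φ (setCl ω T) *
        rcCondS w q S T (fun A => h A (setCl ω T)) (setCl ω T) * ind D ω) := by
    rw [rc_set_sum_cond_cluster' w hq S T (fun A B => rcCondS w q S T φ B * h A B) hD]
    refine Finset.sum_congr rfl fun ω _ => ?_
    congr 1
    congr 1
    have hc : rcCondS w q S T (fun A => h A (setCl ω T)) (setCl ω T) =
        ∑ η, rcMass (delW w (barOf T (setCl ω T))) q η * h (setCl η S) (setCl ω T) := rfl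
    rw [hc, Finset.mul_sum]
    refine Finset.sum_congr rfl fun η _ => ?_
    ring
  -- (e4): `E[(Aφ)(C_T) h(C_S, C_T) 1_D] = E[1_D Σ_η φ^{C_S}(η) (Aφ)(C_T(η)) h(C_S, C_T(η))]` (the `T`-half-step)
  have e4 : ∑ ω, rcMass w q ω * (rcCondS w q S T φ (setCl ω T) * h (setCl ω S) (setCl ω T) * ind D ω) =
      ∑ ω, rcMass w q ω * ((∑ η, rcMass (delW w (barOf S (setCl ω S))) q η *
        (rcCondS w q S T φ (setCl η T) * h (setCl ω S) (setCl η T))) * ind D ω) :=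
    rc_set_sum_cond_cluster w hq S T (fun A B => rcCondS w q S T φ B * h A B) hD
  -- (e7): `E[(𝑇φ)(C_S) h(C_S, C_T) 1_D] = E[1_D (𝑇φ)(C_S) Σ_η φ^{C_S}(η) h(C_S, C_T(η))]`
  have e7 : ∑ ω, rcMass w q ω * (rcGibbsT w q S T φ (setCl ω S) * h (setCl ω S) (setCl ω T) * ind D ω) =
      ∑ ω, rcMass w q ω * (rcGibbsT w q S T φ (setCl ω S) *
        (∑ η, rcMass (delW w (barOf S (setCl ω S))) q η * h (setCl ω S) (setCl η T)) * ind D ω) := by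
    rw [rc_set_sum_cond_cluster w hq S T (fun A B => rcGibbsT w q S T φ A * h A B) hD]
    refine Finset.sum_congr rfl fun ω _ => ?_
    congr 1
    congr 1
    rw [Finset.mul_sum]
    exact Finset.sum_congr rfl fun η _ => by ring
  -- (e6): `E[(𝑇φ)(C_S) 1_D] = E[(Aφ)(C_T) 1_D]`
  have e6 : ∑ ω, rcMass w q ω * (rcGibbsT w q S T φ (setCl ω S) * ind D ω) =
      ∑ ω, rcMass w q ω * (rcCondS w q S T φ (setCl ω T) * ind D ω) :=
    (rc_set_sum_cond_cluster w hq S T (fun _ B => rcCondS w q S T φ B) hD).symm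
  -- the within part as a difference
  have hW : rcWithinDST w q S T D φ h =
      (∑ ω, rcMass w q ω *
          (rcCondS w q S T (fun A => φ A * h A (setCl ω T)) (setCl ω T) * ind D ω)) -
        ∑ ω, rcMass w q ω * (rcCondS w q S T φ (setCl ω T) *
          rcCondS w q S T (fun A => h A (setCl ω T)) (setCl ω T) * ind D ω) := by
    rw [rcWithinDST, ← Finset.sum_sub_distrib]
    exact Finset.sum_congr rfl fun ω _ => by rw [rcCondCovST]; ring
  -- the cross part as a difference
  have hX : rcCrossDST w q S T D φ h =
      (∑ ω, rcMass w q ω * ((∑ η, rcMass (delW w (barOf S (setCl ω S))) q η *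
        (rcCondS w q S T φ (setCl η T) * h (setCl ω S) (setCl η T))) * ind D ω)) -
        ∑ ω, rcMass w q ω * (rcGibbsT w q S T φ (setCl ω S) *
          (∑ η, rcMass (delW w (barOf S (setCl ω S))) q η * h (setCl ω S) (setCl η T)) * ind D ω) := by
    rw [rcCrossDST, ← Finset.sum_sub_distrib]
    exact Finset.sum_congr rfl fun ω _ => by ring
  rw [rcCovDST, rcCovDST, e1, e2, e3, hW, hX, ← e4, e5, ← e7, e6]
  ring

variable {w q}

/-- **The cross term is nonnegative** (`q ≥ 1`) for monotone `φ` and a joint test DECREASING in the conditioning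
cluster: given `C_S`, the new `C_T'` is increasing in the fresh configuration, `(Aφ)(C_T')` and `h(C_S, C_T')` are
both decreasing in it, and the FKG inequality of `φ_{G − C̄_S, q}` (Lemma 2.2) applies.
[cite: VandenbergHaggstromKahn2005, §2.1 Lemma 2.2 (p. 10), Remark 2.8 (p. 12); Grimmett2006, Thm. (3.8)] -/
theorem rcCrossDST_nonneg (hq : 1 ≤ q) (D : Set (Set (Sym2 V))) {φ : Set (Sym2 V) → ℝ} (hφ : Monotone φ)
    {h : Set (Sym2 V) → Set (Sym2 V) → ℝ} (hh : ∀ A, Antitone (h A)) :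
    0 ≤ rcCrossDST w q S T D φ h := by
  have hq0 : 0 < q := one_pos.trans_le hq
  refine Finset.sum_nonneg fun ω _ => mul_nonneg (rcMass_nonneg w hq0 ω)
    (mul_nonneg (sub_nonneg.2 ?_) (ind_nonneg D ω))
  set A : Set (Sym2 V) := setCl ω S with hA
  set f : Set (Sym2 V) → ℝ := fun η => rcCondS w q S T φ (setCl η T) with hf
  set g : Set (Sym2 V) → ℝ := fun η => h A (setCl η T) with hg
  have hfa : Antitone f := fun η η' hηη' => rcCondS_antitone S T hq hφ (setCl_mono hηη' T)
  have hga : Antitone g := fun η η' hηη' => hh A (setCl_mono hηη' T)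
  have key := rcMass_fkg_anti (delW w (barOf S A)) hq hfa hga
  have hT : rcGibbsT w q S T φ A = ∑ η, rcMass (delW w (barOf S A)) q η * f η := rfl
  rw [hT]
  exact key

variable (w q)

/-- **Telescoped form, joint test** (`q > 0`): `cov_D(φ, h) = φ(D) Σ_{k<n} (R(𝑇ᵏφ) + X(𝑇ᵏφ)) + cov_D(𝑇ⁿφ, h)`.
[cite: VandenbergHaggstromKahn2005, §2.1 pp. 10–11 — corollary, derived here] -/
theorem rcCovDST_eq_sum_withinDST_add (hq : 0 < q) {D : Set (Set (Sym2 V))}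
    (hD : ∀ ω, ω ∈ D ↔ ∀ s ∈ S, ∀ t ∈ T, ¬ (openGraph ω).Reachable s t)
    (φ : Set (Sym2 V) → ℝ) (h : Set (Sym2 V) → Set (Sym2 V) → ℝ) (n : ℕ) :
    rcCovDST w q S T D φ h = (∑ ω, rcMass w q ω * ind D ω) *
        ∑ k ∈ Finset.range n, (rcWithinDST w q S T D ((rcGibbsT w q S T)^[k] φ) h +
          rcCrossDST w q S T D ((rcGibbsT w q S T)^[k] φ) h) +
      rcCovDST w q S T D ((rcGibbsT w q S T)^[n] φ) h := by
  induction n with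
  | zero => simp
  | succ n ih =>
    rw [Finset.sum_range_succ, mul_add, Function.iterate_succ_apply', ih,
      rcCovDST_eq_withinDST_add w q S T hq hD ((rcGibbsT w q S T)^[n] φ) h]
    ring

variable {w q}

/-- `cov_D(φ − c, h) = cov_D(φ, h)` (joint test). [folklore] -/
private theorem rcCovDST_sub_const (D : Set (Set (Sym2 V))) (φ : Set (Sym2 V) → ℝ)
    (h : Set (Sym2 V) → Set (Sym2 V) → ℝ) (c : ℝ) :
    rcCovDST w q S T D (fun A => φ A - c) h = rcCovDST w q S T D φ h := by
  have h1 : ∀ ω : Set (Sym2 V),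
      rcMass w q ω * ((φ (setCl ω S) - c) * h (setCl ω S) (setCl ω T) * ind D ω) =
      rcMass w q ω * (φ (setCl ω S) * h (setCl ω S) (setCl ω T) * ind D ω) -
        c * (rcMass w q ω * (h (setCl ω S) (setCl ω T) * ind D ω)) := fun ω => by ring
  have h2 : ∀ ω : Set (Sym2 V), rcMass w q ω * ((φ (setCl ω S) - c) * ind D ω) =
      rcMass w q ω * (φ (setCl ω S) * ind D ω) - c * (rcMass w q ω * ind D ω) := fun ω => by ring
  simp only [rcCovDST, h1, h2, Finset.sum_sub_distrib, ← Finset.mul_sum]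
  ring

/-- **Small oscillation ⟹ small covariance** (joint test, `q > 0`): if `φ A − φ A' ≤ δ` for all `A, A'` and
`|h| ≤ M`, then `|cov_D(φ, h)| ≤ 2 δ M`. [folklore] -/
private theorem abs_rcCovDST_le (hq : 0 < q) (D : Set (Set (Sym2 V))) {φ : Set (Sym2 V) → ℝ}
    {h : Set (Sym2 V) → Set (Sym2 V) → ℝ} {δ M : ℝ} (hφ : ∀ A A', φ A - φ A' ≤ δ)
    (hM : ∀ A B, |h A B| ≤ M) :
    |rcCovDST w q S T D φ h| ≤ 2 * δ * M := by
  have hδ : 0 ≤ δ := by simpa using hφ ∅ ∅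
  have hM0 : 0 ≤ M := (abs_nonneg _).trans (hM ∅ ∅)
  set mD : ℝ := ∑ ω, rcMass w q ω * ind D ω with hmD
  have hmD0 : 0 ≤ mD := Finset.sum_nonneg fun ω _ => mul_nonneg (rcMass_nonneg w hq ω) (ind_nonneg D ω)
  have hmD1 : mD ≤ 1 := by
    calc mD ≤ ∑ ω, rcMass w q ω := Finset.sum_le_sum fun ω _ => by
            simpa using mul_le_mul_of_nonneg_left (ind_le_one D ω) (rcMass_nonneg w hq ω)
      _ = 1 := sum_rcMass w hq
  rw [← rcCovDST_sub_const S T D φ h (φ ∅)]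
  set ψ : Set (Sym2 V) → ℝ := fun A => φ A - φ ∅ with hψ
  have hψb : ∀ A, |ψ A| ≤ δ := fun A => abs_sub_le_iff.2 ⟨hφ A ∅, by linarith [hφ ∅ A]⟩
  have b1 : |∑ ω, rcMass w q ω * (ψ (setCl ω S) * h (setCl ω S) (setCl ω T) * ind D ω)| ≤
      δ * M * mD := by
    have := abs_sum_rcMass_ind_le (w := w) hq D
      (g := fun ω => ψ (setCl ω S) * h (setCl ω S) (setCl ω T)) (c := δ * M)
      (fun ω => by rw [abs_mul]; exact mul_le_mul (hψb _) (hM _ _) (abs_nonneg _) hδ)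
    simpa only [hmD] using this
  have b2 : |∑ ω, rcMass w q ω * (ψ (setCl ω S) * ind D ω)| ≤ δ * mD :=
    abs_sum_rcMass_ind_le hq D (g := fun ω => ψ (setCl ω S)) (fun ω => hψb _)
  have b3 : |∑ ω, rcMass w q ω * (h (setCl ω S) (setCl ω T) * ind D ω)| ≤ M * mD :=
    abs_sum_rcMass_ind_le hq D (g := fun ω => h (setCl ω S) (setCl ω T)) (fun ω => hM _ _)
  have hcov : rcCovDST w q S T D ψ h =
      mD * (∑ ω, rcMass w q ω * (ψ (setCl ω S) * h (setCl ω S) (setCl ω T) * ind D ω)) -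
        (∑ ω, rcMass w q ω * (ψ (setCl ω S) * ind D ω)) *
          (∑ ω, rcMass w q ω * (h (setCl ω S) (setCl ω T) * ind D ω)) := rfl
  rw [hcov]
  have t1 : |mD * ∑ ω, rcMass w q ω * (ψ (setCl ω S) * h (setCl ω S) (setCl ω T) * ind D ω)| ≤
      δ * M := by
    rw [abs_mul, abs_of_nonneg hmD0]
    calc mD * |∑ ω, rcMass w q ω * (ψ (setCl ω S) * h (setCl ω S) (setCl ω T) * ind D ω)|
        ≤ 1 * (δ * M * mD) := mul_le_mul hmD1 b1 (abs_nonneg _) zero_le_one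
      _ ≤ δ * M := by rw [one_mul]; exact mul_le_of_le_one_right (mul_nonneg hδ hM0) hmD1
  have t2 : |(∑ ω, rcMass w q ω * (ψ (setCl ω S) * ind D ω)) *
      (∑ ω, rcMass w q ω * (h (setCl ω S) (setCl ω T) * ind D ω))| ≤ δ * M := by
    rw [abs_mul]
    calc |∑ ω, rcMass w q ω * (ψ (setCl ω S) * ind D ω)| *
          |∑ ω, rcMass w q ω * (h (setCl ω S) (setCl ω T) * ind D ω)|
        ≤ (δ * mD) * (M * mD) := mul_le_mul b2 b3 (abs_nonneg _) (by positivity)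
      _ ≤ δ * M := by nlinarith [mul_nonneg hδ hM0, mul_le_one₀ hmD1 hmD0 hmD1]
  calc |mD * (∑ ω, rcMass w q ω * (ψ (setCl ω S) * h (setCl ω S) (setCl ω T) * ind D ω)) -
        (∑ ω, rcMass w q ω * (ψ (setCl ω S) * ind D ω)) *
          (∑ ω, rcMass w q ω * (h (setCl ω S) (setCl ω T) * ind D ω))|
      ≤ |mD * ∑ ω, rcMass w q ω * (ψ (setCl ω S) * h (setCl ω S) (setCl ω T) * ind D ω)| +
          |(∑ ω, rcMass w q ω * (ψ (setCl ω S) * ind D ω)) *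
            (∑ ω, rcMass w q ω * (h (setCl ω S) (setCl ω T) * ind D ω))| := abs_sub _ _
    _ ≤ 2 * δ * M := by linarith

/-! ### The reduction theorem for a joint test -/

/-- **Reduction of a conditional covariance sign to the averaged one-step covariances, for `φ_{𝐩,q}` (`q ≥ 1`)
and a test of BOTH clusters.**  Parameters `w ∈ [0,1]^{Sym2 V}` on a finite vertex type such that every non-loop
pair meeting `T` has `w e < 1`; `D = {S ↮ T}`; `h(C_S, C_T)` ANY joint test that is DECREASING in the second
(conditioning) cluster.  If `R(g) = E[Cov(g(C_S), h(C_S, C_T) | C_T); D] ≥ 0` for every monotone nonnegative `g`,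
then `cov_D(f, h) = φ(D)E[f h 1_D] − E[f 1_D]E[h 1_D] ≥ 0` for every monotone `f`.  Proof: the telescoped
decomposition; the within terms are `≥ 0` by hypothesis, the cross terms by FKG (`rcCrossDST_nonneg`), and the
tail is `O((1−ε)ⁿ)`.
[cite: VandenbergHaggstromKahn2005, §2.1 pp. 10–13 (the chain, Lemma 2.2, Claim 2.5, Remark 2.8) — corollary, derived here] -/
theorem rcCovDST_nonneg_of_withinDST_nonneg (hq : 1 ≤ q) {D : Set (Set (Sym2 V))}
    (hD : ∀ ω, ω ∈ D ↔ ∀ s ∈ S, ∀ t ∈ T, ¬ (openGraph ω).Reachable s t)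
    (hε : 0 < regenWeight (fun e => (w e : ℝ)) T) {h : Set (Sym2 V) → Set (Sym2 V) → ℝ}
    (hh : ∀ A, Antitone (h A))
    (hR : ∀ g : Set (Sym2 V) → ℝ, Monotone g → (∀ A, 0 ≤ g A) → 0 ≤ rcWithinDST w q S T D g h)
    {f : Set (Sym2 V) → ℝ} (hf : Monotone f) : 0 ≤ rcCovDST w q S T D f h := by
  have hq0 : 0 < q := one_pos.trans_le hq
  set f₀ : Set (Sym2 V) → ℝ := fun A => f A - f ∅ with hf₀
  have hf₀m : Monotone f₀ := fun A A' hAA' => sub_le_sub_right (hf hAA') _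
  have hf₀0 : ∀ A, 0 ≤ f₀ A := fun A => sub_nonneg.2 (hf (Set.empty_subset A))
  set c : ℝ := f Set.univ - f ∅ with hc
  have hosc : ∀ A A', f₀ A - f₀ A' ≤ c := fun A A' => by
    simp only [hf₀, hc]
    linarith [hf (Set.subset_univ A), hf (Set.empty_subset A')]
  set M : ℝ := ∑ A : Set (Sym2 V), ∑ B : Set (Sym2 V), |h A B| with hMdef
  have hM : ∀ A B, |h A B| ≤ M := fun A B =>
    (Finset.single_le_sum (f := fun B' => |h A B'|) (fun _ _ => abs_nonneg _) (Finset.mem_univ B)).trans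
      (Finset.single_le_sum (f := fun A' => ∑ B' : Set (Sym2 V), |h A' B'|)
        (fun _ _ => Finset.sum_nonneg fun _ _ => abs_nonneg _) (Finset.mem_univ A))
  set mD : ℝ := ∑ ω, rcMass w q ω * ind D ω with hmD
  have hmD0 : 0 ≤ mD := Finset.sum_nonneg fun ω _ => mul_nonneg (rcMass_nonneg w hq0 ω) (ind_nonneg D ω)
  set ρ : ℝ := 1 - regenWeight (fun e => (w e : ℝ)) T with hρ
  have hρ0 : 0 ≤ ρ := sub_nonneg.2 (regenWeight_coe_le_one (w := w) T)
  have hρ1 : ρ < 1 := by simp only [hρ]; linarith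
  -- the lower bound for every `n`
  have key : ∀ n : ℕ, -(2 * (ρ ^ n * c) * M) ≤ rcCovDST w q S T D f₀ h := by
    intro n
    rw [rcCovDST_eq_sum_withinDST_add w q S T hq0 hD f₀ h n]
    have h1 : 0 ≤ mD * ∑ k ∈ Finset.range n, (rcWithinDST w q S T D ((rcGibbsT w q S T)^[k] f₀) h +
        rcCrossDST w q S T D ((rcGibbsT w q S T)^[k] f₀) h) :=
      mul_nonneg hmD0 (Finset.sum_nonneg fun k _ => add_nonneg
        (hR _ (rcGibbsT_iterate_mono_nonneg S T hq hf₀m hf₀0 k).1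
          (rcGibbsT_iterate_mono_nonneg S T hq hf₀m hf₀0 k).2)
        (rcCrossDST_nonneg S T hq D (rcGibbsT_iterate_mono_nonneg S T hq hf₀m hf₀0 k).1 hh))
    have h2 : |rcCovDST w q S T D ((rcGibbsT w q S T)^[n] f₀) h| ≤ 2 * (ρ ^ n * c) * M :=
      abs_rcCovDST_le S T hq0 D (rcGibbsT_iterate_sub_le S T hq n hosc) hM
    linarith [neg_abs_le (rcCovDST w q S T D ((rcGibbsT w q S T)^[n] f₀) h)]
  -- let `n → ∞`
  have hlim : Filter.Tendsto (fun n : ℕ => -(2 * (ρ ^ n * c) * M)) Filter.atTop (nhds 0) := by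
    have h0 : Filter.Tendsto (fun n : ℕ => ρ ^ n) Filter.atTop (nhds 0) :=
      tendsto_pow_atTop_nhds_zero_of_lt_one hρ0 hρ1
    have : Filter.Tendsto (fun n : ℕ => -(2 * (ρ ^ n * c) * M)) Filter.atTop
        (nhds (-(2 * (0 * c) * M))) :=
      (((h0.mul_const c).const_mul 2).mul_const M).neg
    simpa using this
  have hge : 0 ≤ rcCovDST w q S T D f₀ h := le_of_tendsto' hlim key
  rwa [hf₀, rcCovDST_sub_const] at hge

end JointSums

end BHK2006

/-! ### Joint tests: measure-level statement for `rcMeasureW w q ∅`, one source vertex `s`, an avoided set `X` -/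

section JointMeasure

variable {V : Type*} [Fintype V]

open scoped Classical
open BHK2006 DecisionTree

/-- `∫_D ψ(C_s, C_X) dφ` as a finite sum against the point masses (joint integrand, `q > 0`).
[cite: VandenbergHaggstromKahn2005, §2.1 eq. (11) (p. 9)] -/
private theorem rc_setIntegral_D_eq_sum₂ (w : Sym2 V → unitInterval) {q : ℝ} (hq : 0 < q) (s : V) (X : Set V)
    (D : Set (BondConfig V)) (ψ : Set (Sym2 V) → Set (Sym2 V) → ℝ) :
    ∫ ω in D, ψ (openEdgeCluster ω s) (setCl ω X) ∂(rcMeasureW w q ∅) =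
      ∑ ω, rcMass w q ω * (ψ (setCl ω {s}) (setCl ω X) * ind D ω) := by
  rw [setIntegral_rcMeasureW_eq_sum w hq]
  refine Finset.sum_congr rfl fun ω _ => ?_
  rw [setCl_singleton]

/-- **Reduction theorem for `φ_{𝐩,q}` (`q ≥ 1`) and a joint test, measure form.**  `φ = rcMeasureW w q ∅` on a finite
vertex type, a vertex `s`, a vertex set `X` such that every non-loop pair meeting `X` has `w e < 1`, `D = {s ↮ X}`,
`C_s` the open edge cluster of `s`, `C_X = setCl ω X` the open edge cluster of the set `X`, the world
`φ^ω = rcMeasureW (delW w A_X(ω)) q ∅` (pairs meeting the open vertex cluster of `X` deleted, same `q`; Lemma 2.3), and a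
joint test `h(C_s, C_X)` that is DECREASING in `C_X`.  If for every monotone nonnegative `g`
`0 ≤ ∫_D ( E_{φ^ω}[g(C_s) h(C_s, C_X ω)] − E_{φ^ω}[g(C_s)]·E_{φ^ω}[h(C_s, C_X ω)] ) dφ(ω)`
(the conditional covariance of `g(C_s)` and `h(C_s, C_X)` given the cluster of `X`, averaged over `D`), then for every
monotone `f`
`0 ≤ φ(D) ∫_D f(C_s) h(C_s, C_X) dφ − (∫_D f(C_s) dφ)(∫_D h(C_s, C_X) dφ)`.
At `q = 1` this is the tree's `BHK2006_clusterJointTestCov_nonneg_of_within`.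
[cite: VandenbergHaggstromKahn2005, §2.1 pp. 10–13 (Lemmas 2.2–2.4, the chain, Remark 2.8) — corollary, derived here] -/
theorem BHK2006_clusterJointTestCov_nonneg_of_within_rc (w : Sym2 V → unitInterval) {q : ℝ} (hq : 1 ≤ q)
    (s : V) (X : Set V) (hX : ∀ e : Sym2 V, ¬ e.IsDiag → (∃ v ∈ e, v ∈ X) → (w e : ℝ) < 1)
    (h : Set (Sym2 V) → Set (Sym2 V) → ℝ) (hh : ∀ A, Antitone (h A))
    (hR : ∀ g : Set (Sym2 V) → ℝ, Monotone g → (∀ C, 0 ≤ g C) →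
      0 ≤ ∫ ω in {ω : BondConfig V | ∀ x ∈ X, ¬ (openGraph ω).Reachable s x},
        ((∫ η, g (openEdgeCluster η s) * h (openEdgeCluster η s) (setCl ω X)
            ∂(rcMeasureW (delW w {e | ∃ v ∈ e, ∃ x ∈ X, (openGraph ω).Reachable x v}) q ∅)) -
          (∫ η, g (openEdgeCluster η s)
            ∂(rcMeasureW (delW w {e | ∃ v ∈ e, ∃ x ∈ X, (openGraph ω).Reachable x v}) q ∅)) *
          (∫ η, h (openEdgeCluster η s) (setCl ω X)
            ∂(rcMeasureW (delW w {e | ∃ v ∈ e, ∃ x ∈ X, (openGraph ω).Reachable x v}) q ∅)))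
        ∂(rcMeasureW w q ∅))
    (f : Set (Sym2 V) → ℝ) (hf : Monotone f) :
    0 ≤ (rcMeasureW w q ∅).real {ω : BondConfig V | ∀ x ∈ X, ¬ (openGraph ω).Reachable s x} *
        (∫ ω in {ω : BondConfig V | ∀ x ∈ X, ¬ (openGraph ω).Reachable s x},
          f (openEdgeCluster ω s) * h (openEdgeCluster ω s) (setCl ω X) ∂(rcMeasureW w q ∅)) -
      (∫ ω in {ω : BondConfig V | ∀ x ∈ X, ¬ (openGraph ω).Reachable s x},
          f (openEdgeCluster ω s) ∂(rcMeasureW w q ∅)) *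
        (∫ ω in {ω : BondConfig V | ∀ x ∈ X, ¬ (openGraph ω).Reachable s x},
          h (openEdgeCluster ω s) (setCl ω X) ∂(rcMeasureW w q ∅)) := by
  classical
  have hq0 : 0 < q := one_pos.trans_le hq
  set D : Set (BondConfig V) := {ω | ∀ x ∈ X, ¬ (openGraph ω).Reachable s x} with hDdef
  have hD : ∀ ω, ω ∈ D ↔ ∀ s' ∈ ({s} : Set V), ∀ t ∈ X, ¬ (openGraph ω).Reachable s' t := by
    intro ω; simp only [hDdef, Set.mem_setOf_eq, Set.mem_singleton_iff, forall_eq]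
  -- positivity of the regeneration weight
  have hε : 0 < regenWeight (fun e => (w e : ℝ)) X := by
    rw [regenWeight_eq_prod w X]
    refine Finset.prod_pos fun e he => ?_
    obtain ⟨hd, hv⟩ := (Finset.mem_filter.1 he).2
    exact sub_pos.2 (hX e hd hv)
  -- the conclusion in sum form
  have hcov : (rcMeasureW w q ∅).real D * (∫ ω in D, f (openEdgeCluster ω s) *
      h (openEdgeCluster ω s) (setCl ω X) ∂(rcMeasureW w q ∅)) -
      (∫ ω in D, f (openEdgeCluster ω s) ∂(rcMeasureW w q ∅)) *
        (∫ ω in D, h (openEdgeCluster ω s) (setCl ω X) ∂(rcMeasureW w q ∅)) =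
      rcCovDST w q {s} X D f h := by
    rw [rcCovDST, rcMeasureW_real_eq_sum_rcMass w hq0 D,
      rc_setIntegral_D_eq_sum₂ w hq0 s X D (fun C B => f C * h C B),
      rc_setIntegral_D_eq_sum₂ w hq0 s X D (fun C _ => f C), rc_setIntegral_D_eq_sum₂ w hq0 s X D h]
  rw [hcov]
  refine rcCovDST_nonneg_of_withinDST_nonneg {s} X hq hD hε hh (fun g hg hg0 => ?_) hf
  -- the hypothesis in sum form
  have hwithin : ∫ ω in D,
      ((∫ η, g (openEdgeCluster η s) * h (openEdgeCluster η s) (setCl ω X)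
          ∂(rcMeasureW (delW w {e | ∃ v ∈ e, ∃ x ∈ X, (openGraph ω).Reachable x v}) q ∅)) -
        (∫ η, g (openEdgeCluster η s)
          ∂(rcMeasureW (delW w {e | ∃ v ∈ e, ∃ x ∈ X, (openGraph ω).Reachable x v}) q ∅)) *
        (∫ η, h (openEdgeCluster η s) (setCl ω X)
          ∂(rcMeasureW (delW w {e | ∃ v ∈ e, ∃ x ∈ X, (openGraph ω).Reachable x v}) q ∅)))
      ∂(rcMeasureW w q ∅) = rcWithinDST w q {s} X D g h := by
    rw [rcWithinDST, setIntegral_rcMeasureW_eq_sum w hq0]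
    refine Finset.sum_congr rfl fun ω _ => ?_
    rw [rcCondCovST, integral_rcWorld_eq_rcCondS w hq0 s X (fun A => g A * h A (setCl ω X)) ω,
      integral_rcWorld_eq_rcCondS w hq0 s X g ω,
      integral_rcWorld_eq_rcCondS w hq0 s X (fun A => h A (setCl ω X)) ω]
  rw [← hwithin]
  exact hR g hg hg0

end JointMeasure

/-! ### The multi-marker form with a HUB TEST `1{Σ ↔ s}·1{Σ ↮ X}` (the shape of the MIXED conditioned slack hierarchy) -/

section Hub

variable {V : Type*} [Fintype V]

open scoped Classical
open BHK2006 DecisionTree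

/-- `∫_D F · 1_A = ∫_{D ∩ A} F`. [folklore] -/
private theorem setIntegral_mul_indicator_one_rc (μ : Measure (BondConfig V)) (D A : Set (BondConfig V))
    (F : BondConfig V → ℝ) :
    ∫ ω in D, F ω * A.indicator 1 ω ∂μ = ∫ ω in D ∩ A, F ω ∂μ := by
  have hA : MeasurableSet A := MeasurableSet.of_discrete
  have e : (fun ω => F ω * A.indicator (1 : BondConfig V → ℝ) ω) = A.indicator F := by
    funext ω
    by_cases hω : ω ∈ A
    · rw [Set.indicator_of_mem hω, Set.indicator_of_mem hω, Pi.one_apply, mul_one]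
    · rw [Set.indicator_of_notMem hω, Set.indicator_of_notMem hω, mul_zero]
  rw [e, setIntegral_indicator hA]

/-- `∫ F · 1_A = ∫_A F`. [folklore] -/
private theorem integral_mul_indicator_one_rc (μ : Measure (BondConfig V)) (A : Set (BondConfig V))
    (F : BondConfig V → ℝ) :
    ∫ ω, F ω * A.indicator 1 ω ∂μ = ∫ ω in A, F ω ∂μ := by
  have h := setIntegral_mul_indicator_one_rc μ Set.univ A F
  rwa [Measure.restrict_univ, Set.univ_inter] at h

/-- Hub bookkeeping, world side (any finite measure `ν`, the conditioning cluster FROZEN at `B = C_X(ω)`): with the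
joint test `H(C, B) = Σ_{u∈T} c(u)·χ_u(C) + c₀·1{Σ meets {s} ∪ V(C)}·1{Σ misses X ∪ V(B)}`,
`E_ν[g(C_s) H(C_s, C_X ω)] − E_ν[g(C_s)] E_ν[H(C_s, C_X ω)]
  = Σ_u c(u)·[∫_{s↔u} g dν − (∫ g dν) ν(s↔u)] + c₀·1{Σ ↮ X}(ω)·[∫_{Σ↔s} g dν − (∫ g dν) ν(Σ↔s)]`. [folklore] -/
private theorem hub_world_eq_rc (ν : Measure (BondConfig V)) [IsFiniteMeasure ν] (s : V) (X : Set V)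
    (T : Finset V) (c : V → ℝ) (Sig : Set V) (c₀ : ℝ) (g : Set (Sym2 V) → ℝ) (ω : BondConfig V) :
    ((∫ η, g (openEdgeCluster η s) *
          (fun (C B : Set (Sym2 V)) => (∑ u ∈ T, c u * (if (u = s ∨ ∃ e ∈ C, u ∈ e) then (1 : ℝ) else 0)) +
              c₀ * ((if (∃ z ∈ Sig, z = s ∨ ∃ e ∈ C, z ∈ e) then (1 : ℝ) else 0) *
                (if (∀ z ∈ Sig, ¬ (z ∈ X ∨ ∃ e ∈ B, z ∈ e)) then (1 : ℝ) else 0)))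
            (openEdgeCluster η s) (setCl ω X) ∂ν) -
      (∫ η, g (openEdgeCluster η s) ∂ν) *
      (∫ η, (fun (C B : Set (Sym2 V)) => (∑ u ∈ T, c u * (if (u = s ∨ ∃ e ∈ C, u ∈ e) then (1 : ℝ) else 0)) +
              c₀ * ((if (∃ z ∈ Sig, z = s ∨ ∃ e ∈ C, z ∈ e) then (1 : ℝ) else 0) *
                (if (∀ z ∈ Sig, ¬ (z ∈ X ∨ ∃ e ∈ B, z ∈ e)) then (1 : ℝ) else 0)))
            (openEdgeCluster η s) (setCl ω X) ∂ν)) =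
    (∑ u ∈ T, c u * ((∫ η in (openConn s u : Set (BondConfig V)), g (openEdgeCluster η s) ∂ν) -
          (∫ η, g (openEdgeCluster η s) ∂ν) * ν.real (openConn s u : Set (BondConfig V)))) +
      c₀ * ((if (∀ z ∈ Sig, ∀ x ∈ X, ¬ (openGraph ω).Reachable x z) then (1 : ℝ) else 0) *
        ((∫ η in {η : BondConfig V | ∃ z ∈ Sig, (openGraph η).Reachable s z}, g (openEdgeCluster η s) ∂ν) -
          (∫ η, g (openEdgeCluster η s) ∂ν) *
            ν.real {η : BondConfig V | ∃ z ∈ Sig, (openGraph η).Reachable s z})) := by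
  set r : ℝ := (if (∀ z ∈ Sig, ∀ x ∈ X, ¬ (openGraph ω).Reachable x z) then (1 : ℝ) else 0) with hr
  set Hs : Set (BondConfig V) := {η | ∃ z ∈ Sig, (openGraph η).Reachable s z} with hHs
  set H : Set (Sym2 V) → Set (Sym2 V) → ℝ := fun C B =>
    (∑ u ∈ T, c u * (if (u = s ∨ ∃ e ∈ C, u ∈ e) then (1 : ℝ) else 0)) +
      c₀ * ((if (∃ z ∈ Sig, z = s ∨ ∃ e ∈ C, z ∈ e) then (1 : ℝ) else 0) *
        (if (∀ z ∈ Sig, ¬ (z ∈ X ∨ ∃ e ∈ B, z ∈ e)) then (1 : ℝ) else 0)) with hH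
  have hHω : ∀ η : BondConfig V, H (openEdgeCluster η s) (setCl ω X) =
      (∑ u ∈ T, c u * (openConn s u : Set (BondConfig V)).indicator 1 η) +
        (c₀ * r) * Hs.indicator 1 η := fun η => by
    simp only [hH, ite_mem_openEdgeCluster_eq_indicator, ite_hub_openEdgeCluster_eq_indicator,
      ite_hubAvoid_setCl_eq, hr, hHs]
    ring
  have splitU : ∀ G : BondConfig V → ℝ, ∫ η, G η * H (openEdgeCluster η s) (setCl ω X) ∂ν =
      (∑ u ∈ T, c u * (∫ η in openConn s u, G η ∂ν)) + (c₀ * r) * (∫ η in Hs, G η ∂ν) := by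
    intro G
    have e1 : (fun η => G η * H (openEdgeCluster η s) (setCl ω X)) = fun η =>
        (∑ u ∈ T, c u * (G η * (openConn s u : Set (BondConfig V)).indicator 1 η)) +
          (c₀ * r) * (G η * Hs.indicator 1 η) := by
      funext η
      rw [hHω, mul_add, Finset.mul_sum]
      congr 1
      · exact Finset.sum_congr rfl fun u _ => by ring
      · ring
    rw [e1, integral_add (Integrable.of_finite) (Integrable.of_finite),
      integral_finsetSum _ fun u _ => Integrable.of_finite, integral_const_mul,
      integral_mul_indicator_one_rc]
    congr 1
    exact Finset.sum_congr rfl fun u _ => by rw [integral_const_mul, integral_mul_indicator_one_rc]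
  have massU : ∫ η, H (openEdgeCluster η s) (setCl ω X) ∂ν =
      (∑ u ∈ T, c u * ν.real (openConn s u : Set (BondConfig V))) + (c₀ * r) * ν.real Hs := by
    have h2 := splitU (fun _ => (1 : ℝ))
    simp only [one_mul] at h2
    rw [h2]
    congr 1
    · exact Finset.sum_congr rfl fun u _ => by rw [setIntegral_const, smul_eq_mul, mul_one]
    · rw [setIntegral_const, smul_eq_mul, mul_one]
  rw [splitU, massU, mul_add, Finset.mul_sum]
  have e3 : ∑ u ∈ T, c u * ((∫ η in (openConn s u : Set (BondConfig V)), g (openEdgeCluster η s) ∂ν) -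
        (∫ η, g (openEdgeCluster η s) ∂ν) * ν.real (openConn s u : Set (BondConfig V))) =
      (∑ u ∈ T, c u * (∫ η in (openConn s u : Set (BondConfig V)), g (openEdgeCluster η s) ∂ν)) -
        ∑ u ∈ T, (∫ η, g (openEdgeCluster η s) ∂ν) *
          (c u * ν.real (openConn s u : Set (BondConfig V))) := by
    rw [← Finset.sum_sub_distrib]
    exact Finset.sum_congr rfl fun u _ => by ring
  rw [e3]
  ring

/-- Hub bookkeeping, conclusion side (any finite measure `μ`): with the same joint test `H`,
`μ(D)∫_D f·H(C_s, C_X) − (∫_D f)(∫_D H) = Σ_u c(u)·[μ(D)∫_{D∩{s↔u}} f − (∫_D f) μ(D∩{s↔u})] + c₀·[μ(D)∫_{D ∩ Hub} f − (∫_D f) μ(D ∩ Hub)]`,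
`Hub = {Σ ↔ s} ∩ {Σ ↮ X}`. [folklore] -/
private theorem hub_conclusion_eq_rc (μ : Measure (BondConfig V)) [IsFiniteMeasure μ] (D : Set (BondConfig V))
    (s : V) (X : Set V) (T : Finset V) (c : V → ℝ) (Sig : Set V) (c₀ : ℝ) (f : Set (Sym2 V) → ℝ) :
    μ.real D * (∫ ω in D, f (openEdgeCluster ω s) *
            (fun (C B : Set (Sym2 V)) => (∑ u ∈ T, c u * (if (u = s ∨ ∃ e ∈ C, u ∈ e) then (1 : ℝ) else 0)) +
              c₀ * ((if (∃ z ∈ Sig, z = s ∨ ∃ e ∈ C, z ∈ e) then (1 : ℝ) else 0) *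
                (if (∀ z ∈ Sig, ¬ (z ∈ X ∨ ∃ e ∈ B, z ∈ e)) then (1 : ℝ) else 0)))
              (openEdgeCluster ω s) (setCl ω X) ∂μ) -
      (∫ ω in D, f (openEdgeCluster ω s) ∂μ) *
        (∫ ω in D,
          (fun (C B : Set (Sym2 V)) => (∑ u ∈ T, c u * (if (u = s ∨ ∃ e ∈ C, u ∈ e) then (1 : ℝ) else 0)) +
              c₀ * ((if (∃ z ∈ Sig, z = s ∨ ∃ e ∈ C, z ∈ e) then (1 : ℝ) else 0) *
                (if (∀ z ∈ Sig, ¬ (z ∈ X ∨ ∃ e ∈ B, z ∈ e)) then (1 : ℝ) else 0)))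
            (openEdgeCluster ω s) (setCl ω X) ∂μ) =
    (∑ u ∈ T, c u * (μ.real D * (∫ ω in D ∩ openConn s u, f (openEdgeCluster ω s) ∂μ) -
        (∫ ω in D, f (openEdgeCluster ω s) ∂μ) * μ.real (D ∩ openConn s u))) +
      c₀ * (μ.real D * (∫ ω in D ∩
              {ω | (∃ z ∈ Sig, (openGraph ω).Reachable s z) ∧ ∀ z ∈ Sig, ∀ x ∈ X, ¬ (openGraph ω).Reachable x z},
            f (openEdgeCluster ω s) ∂μ) -
        (∫ ω in D, f (openEdgeCluster ω s) ∂μ) * μ.real (D ∩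
            {ω | (∃ z ∈ Sig, (openGraph ω).Reachable s z) ∧ ∀ z ∈ Sig, ∀ x ∈ X, ¬ (openGraph ω).Reachable x z})) := by
  set Hub : Set (BondConfig V) :=
    {ω | (∃ z ∈ Sig, (openGraph ω).Reachable s z) ∧ ∀ z ∈ Sig, ∀ x ∈ X, ¬ (openGraph ω).Reachable x z} with hHub
  set H : Set (Sym2 V) → Set (Sym2 V) → ℝ := fun C B =>
    (∑ u ∈ T, c u * (if (u = s ∨ ∃ e ∈ C, u ∈ e) then (1 : ℝ) else 0)) +
      c₀ * ((if (∃ z ∈ Sig, z = s ∨ ∃ e ∈ C, z ∈ e) then (1 : ℝ) else 0) *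
        (if (∀ z ∈ Sig, ¬ (z ∈ X ∨ ∃ e ∈ B, z ∈ e)) then (1 : ℝ) else 0)) with hH
  have hHω : ∀ η : BondConfig V, H (openEdgeCluster η s) (setCl η X) =
      (∑ u ∈ T, c u * (openConn s u : Set (BondConfig V)).indicator 1 η) + c₀ * Hub.indicator 1 η := by
    intro η
    simp only [hH, ite_mem_openEdgeCluster_eq_indicator, ite_hub_openEdgeCluster_eq_indicator,
      ite_hubAvoid_setCl_eq]
    congr 2
    by_cases h1 : ∃ z ∈ Sig, (openGraph η).Reachable s z
    · by_cases h2 : ∀ z ∈ Sig, ∀ x ∈ X, ¬ (openGraph η).Reachable x z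
      · rw [Set.indicator_of_mem
          (show η ∈ {η' : BondConfig V | ∃ z ∈ Sig, (openGraph η').Reachable s z} from h1), if_pos h2,
          Set.indicator_of_mem (show η ∈ Hub from ⟨h1, h2⟩)]
        simp
      · rw [if_neg h2, Set.indicator_of_notMem (show η ∉ Hub from fun h => h2 h.2), mul_zero]
    · rw [Set.indicator_of_notMem
        (show η ∉ {η' : BondConfig V | ∃ z ∈ Sig, (openGraph η').Reachable s z} from h1),
        Set.indicator_of_notMem (show η ∉ Hub from fun h => h1 h.1), zero_mul]
  have split : ∀ G : BondConfig V → ℝ, ∫ ω in D, G ω * H (openEdgeCluster ω s) (setCl ω X) ∂μ =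
      (∑ u ∈ T, c u * (∫ ω in D ∩ openConn s u, G ω ∂μ)) + c₀ * (∫ ω in D ∩ Hub, G ω ∂μ) := by
    intro G
    have e1 : (fun ω => G ω * H (openEdgeCluster ω s) (setCl ω X)) = fun ω =>
        (∑ u ∈ T, c u * (G ω * (openConn s u : Set (BondConfig V)).indicator 1 ω)) +
          c₀ * (G ω * Hub.indicator 1 ω) := by
      funext ω
      rw [hHω, mul_add, Finset.mul_sum]
      congr 1
      · exact Finset.sum_congr rfl fun u _ => by ring
      · ring
    rw [e1, integral_add (Integrable.of_finite) (Integrable.of_finite),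
      integral_finsetSum _ fun u _ => Integrable.of_finite, integral_const_mul,
      setIntegral_mul_indicator_one_rc]
    congr 1
    exact Finset.sum_congr rfl fun u _ => by rw [integral_const_mul, setIntegral_mul_indicator_one_rc]
  have massD : ∫ ω in D, H (openEdgeCluster ω s) (setCl ω X) ∂μ =
      (∑ u ∈ T, c u * μ.real (D ∩ openConn s u)) + c₀ * μ.real (D ∩ Hub) := by
    have h2 := split (fun _ => (1 : ℝ))
    simp only [one_mul] at h2
    rw [h2]
    congr 1
    · exact Finset.sum_congr rfl fun u _ => by rw [setIntegral_const, smul_eq_mul, mul_one]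
    · rw [setIntegral_const, smul_eq_mul, mul_one]
  rw [split, massD, mul_add, mul_add, Finset.mul_sum, Finset.mul_sum]
  have e3 : ∑ u ∈ T, c u * (μ.real D * (∫ ω in D ∩ openConn s u, f (openEdgeCluster ω s) ∂μ) -
        (∫ ω in D, f (openEdgeCluster ω s) ∂μ) * μ.real (D ∩ openConn s u)) =
      (∑ u ∈ T, μ.real D * (c u * ∫ ω in D ∩ openConn s u, f (openEdgeCluster ω s) ∂μ)) -
        ∑ u ∈ T, (∫ ω in D, f (openEdgeCluster ω s) ∂μ) * (c u * μ.real (D ∩ openConn s u)) := by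
    rw [← Finset.sum_sub_distrib]
    exact Finset.sum_congr rfl fun u _ => by ring
  rw [e3]
  ring

/-- **Reduction theorem for `φ_{𝐩,q}` (`q ≥ 1`), multi-marker form with a hub test, FIXED parameters** (the shape of
the mixed conditioned slack hierarchy: Lemma T with the observer glued to a vertex set).  `φ = rcMeasureW w q ∅` on a
finite vertex type; a source `s`, an avoided set `X` with `w e < 1` on the non-loop pairs meeting `X`; markers `u ∈ T`
with constant coefficients `c(u)` (any signs) and tests `1{s ↔ u}`; a hub set `Σ` with coefficient `c₀ ≥ 0` and the HUB
TEST `1{Σ ↔ s}·1{Σ ↮ X}`; `D = {s ↮ X}`; for each `ω` the world `φ^ω = rcMeasureW (delW w A_X(ω)) q ∅` (pairs meeting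
the open vertex cluster of `X` deleted, same `q`).  If for every monotone nonnegative `g`
`0 ≤ ∫_D ( Σ_{u∈T} c(u)·[∫_{s↔u} g(C_s) dφ^ω − (∫ g(C_s) dφ^ω) φ^ω(s↔u)]`
`        + c₀·1{Σ ↮ X}(ω)·[∫_{Σ↔s} g(C_s) dφ^ω − (∫ g(C_s) dφ^ω) φ^ω(Σ↔s)] ) dφ(ω)`
(in the world `ω` the factor `1{Σ ↮ X}` of the hub test is frozen and the factor `1{Σ ↔ s}` is a marker of the fresh
cluster), then for every monotone `f`
`0 ≤ Σ_{u∈T} c(u)·[φ(D) ∫_{D∩{s↔u}} f(C_s) − (∫_D f(C_s)) φ(D∩{s↔u})] + c₀·[φ(D) ∫_{D∩Hub} f(C_s) − (∫_D f(C_s)) φ(D∩Hub)]`,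
`Hub = {Σ ↔ s} ∩ {Σ ↮ X}`.  (`BHK2006_clusterJointTestCov_nonneg_of_within_rc` for the joint test
`Σ_u c(u)·1{s↔u} + c₀·1{Σ↔s}·1{Σ↮X}`, decreasing in the cluster of `X` because `c₀ ≥ 0`; at `q = 1` the tree's
`BHK2006_multiMarkerHubCov_nonneg_of_within`.)
[cite: VandenbergHaggstromKahn2005, §2.1 pp. 10–13 (the chain) and Lemmas 2.3–2.4 (p. 10) — corollary, derived here] -/
theorem BHK2006_multiMarkerHubCov_nonneg_of_within_rc (w : Sym2 V → unitInterval) {q : ℝ} (hq : 1 ≤ q) (s : V)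
    (X : Set V) (hX : ∀ e : Sym2 V, ¬ e.IsDiag → (∃ v ∈ e, v ∈ X) → (w e : ℝ) < 1) (T : Finset V)
    (c : V → ℝ) (Sig : Set V) (c₀ : ℝ) (hc₀ : 0 ≤ c₀)
    (hR : ∀ g : Set (Sym2 V) → ℝ, Monotone g → (∀ C, 0 ≤ g C) →
      0 ≤ ∫ ω in {ω : BondConfig V | ∀ x ∈ X, ¬ (openGraph ω).Reachable s x},
        ((∑ u ∈ T, c u * ((∫ η in (openConn s u : Set (BondConfig V)), g (openEdgeCluster η s)
                ∂(rcMeasureW (delW w {e | ∃ v ∈ e, ∃ x ∈ X, (openGraph ω).Reachable x v}) q ∅)) -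
              (∫ η, g (openEdgeCluster η s)
                ∂(rcMeasureW (delW w {e | ∃ v ∈ e, ∃ x ∈ X, (openGraph ω).Reachable x v}) q ∅)) *
              (rcMeasureW (delW w {e | ∃ v ∈ e, ∃ x ∈ X, (openGraph ω).Reachable x v}) q ∅).real
                (openConn s u : Set (BondConfig V)))) +
          c₀ * ((if (∀ z ∈ Sig, ∀ x ∈ X, ¬ (openGraph ω).Reachable x z) then (1 : ℝ) else 0) *
            ((∫ η in {η : BondConfig V | ∃ z ∈ Sig, (openGraph η).Reachable s z}, g (openEdgeCluster η s)
                ∂(rcMeasureW (delW w {e | ∃ v ∈ e, ∃ x ∈ X, (openGraph ω).Reachable x v}) q ∅)) -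
              (∫ η, g (openEdgeCluster η s)
                ∂(rcMeasureW (delW w {e | ∃ v ∈ e, ∃ x ∈ X, (openGraph ω).Reachable x v}) q ∅)) *
              (rcMeasureW (delW w {e | ∃ v ∈ e, ∃ x ∈ X, (openGraph ω).Reachable x v}) q ∅).real
                {η : BondConfig V | ∃ z ∈ Sig, (openGraph η).Reachable s z})))
        ∂(rcMeasureW w q ∅))
    (f : Set (Sym2 V) → ℝ) (hf : Monotone f) :
    0 ≤ (∑ u ∈ T, c u *
        ((rcMeasureW w q ∅).real {ω : BondConfig V | ∀ x ∈ X, ¬ (openGraph ω).Reachable s x} *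
            (∫ ω in {ω : BondConfig V | ∀ x ∈ X, ¬ (openGraph ω).Reachable s x} ∩ openConn s u,
              f (openEdgeCluster ω s) ∂(rcMeasureW w q ∅)) -
          (∫ ω in {ω : BondConfig V | ∀ x ∈ X, ¬ (openGraph ω).Reachable s x},
              f (openEdgeCluster ω s) ∂(rcMeasureW w q ∅)) *
            (rcMeasureW w q ∅).real
              ({ω : BondConfig V | ∀ x ∈ X, ¬ (openGraph ω).Reachable s x} ∩ openConn s u))) +
      c₀ * ((rcMeasureW w q ∅).real {ω : BondConfig V | ∀ x ∈ X, ¬ (openGraph ω).Reachable s x} *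
          (∫ ω in {ω : BondConfig V | ∀ x ∈ X, ¬ (openGraph ω).Reachable s x} ∩
              {ω | (∃ z ∈ Sig, (openGraph ω).Reachable s z) ∧ ∀ z ∈ Sig, ∀ x ∈ X, ¬ (openGraph ω).Reachable x z},
            f (openEdgeCluster ω s) ∂(rcMeasureW w q ∅)) -
        (∫ ω in {ω : BondConfig V | ∀ x ∈ X, ¬ (openGraph ω).Reachable s x},
            f (openEdgeCluster ω s) ∂(rcMeasureW w q ∅)) *
          (rcMeasureW w q ∅).real ({ω : BondConfig V | ∀ x ∈ X, ¬ (openGraph ω).Reachable s x} ∩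
            {ω | (∃ z ∈ Sig, (openGraph ω).Reachable s z) ∧
              ∀ z ∈ Sig, ∀ x ∈ X, ¬ (openGraph ω).Reachable x z})) := by
  have hq0 : 0 < q := one_pos.trans_le hq
  haveI := isProbabilityMeasure_rcMeasureW w hq0 ∅
  set H : Set (Sym2 V) → Set (Sym2 V) → ℝ := fun C B =>
    (∑ u ∈ T, c u * (if (u = s ∨ ∃ e ∈ C, u ∈ e) then (1 : ℝ) else 0)) +
      c₀ * ((if (∃ z ∈ Sig, z = s ∨ ∃ e ∈ C, z ∈ e) then (1 : ℝ) else 0) *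
        (if (∀ z ∈ Sig, ¬ (z ∈ X ∨ ∃ e ∈ B, z ∈ e)) then (1 : ℝ) else 0)) with hH
  -- the joint test is decreasing in the conditioning cluster (`c₀ ≥ 0`)
  have hanti : ∀ A, Antitone (H A) := by
    intro A B B' hBB'
    simp only [hH]
    refine add_le_add le_rfl (mul_le_mul_of_nonneg_left (mul_le_mul_of_nonneg_left ?_ ?_) hc₀)
    · by_cases h' : ∀ z ∈ Sig, ¬ (z ∈ X ∨ ∃ e ∈ B', z ∈ e)
      · have h'' : ∀ z ∈ Sig, ¬ (z ∈ X ∨ ∃ e ∈ B, z ∈ e) := fun z hz hor =>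
          h' z hz (hor.imp id fun ⟨e, he, hze⟩ => ⟨e, hBB' he, hze⟩)
        rw [if_pos h', if_pos h'']
      · rw [if_neg h']
        split_ifs <;> norm_num
    · split_ifs <;> norm_num
  have main := BHK2006_clusterJointTestCov_nonneg_of_within_rc w hq s X hX H hanti
    (fun g hg hg0 => by
      have e : ∀ ω : BondConfig V,
          (∫ η, g (openEdgeCluster η s) * H (openEdgeCluster η s) (setCl ω X)
              ∂(rcMeasureW (delW w {e | ∃ v ∈ e, ∃ x ∈ X, (openGraph ω).Reachable x v}) q ∅)) -
            (∫ η, g (openEdgeCluster η s)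
              ∂(rcMeasureW (delW w {e | ∃ v ∈ e, ∃ x ∈ X, (openGraph ω).Reachable x v}) q ∅)) *
            (∫ η, H (openEdgeCluster η s) (setCl ω X)
              ∂(rcMeasureW (delW w {e | ∃ v ∈ e, ∃ x ∈ X, (openGraph ω).Reachable x v}) q ∅)) =
          (∑ u ∈ T, c u * ((∫ η in (openConn s u : Set (BondConfig V)), g (openEdgeCluster η s)
                ∂(rcMeasureW (delW w {e | ∃ v ∈ e, ∃ x ∈ X, (openGraph ω).Reachable x v}) q ∅)) -
              (∫ η, g (openEdgeCluster η s)
                ∂(rcMeasureW (delW w {e | ∃ v ∈ e, ∃ x ∈ X, (openGraph ω).Reachable x v}) q ∅)) *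
              (rcMeasureW (delW w {e | ∃ v ∈ e, ∃ x ∈ X, (openGraph ω).Reachable x v}) q ∅).real
                (openConn s u : Set (BondConfig V)))) +
          c₀ * ((if (∀ z ∈ Sig, ∀ x ∈ X, ¬ (openGraph ω).Reachable x z) then (1 : ℝ) else 0) *
            ((∫ η in {η : BondConfig V | ∃ z ∈ Sig, (openGraph η).Reachable s z}, g (openEdgeCluster η s)
                ∂(rcMeasureW (delW w {e | ∃ v ∈ e, ∃ x ∈ X, (openGraph ω).Reachable x v}) q ∅)) -
              (∫ η, g (openEdgeCluster η s)
                ∂(rcMeasureW (delW w {e | ∃ v ∈ e, ∃ x ∈ X, (openGraph ω).Reachable x v}) q ∅)) *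
              (rcMeasureW (delW w {e | ∃ v ∈ e, ∃ x ∈ X, (openGraph ω).Reachable x v}) q ∅).real
                {η : BondConfig V | ∃ z ∈ Sig, (openGraph η).Reachable s z})) := fun ω => by
        haveI := isProbabilityMeasure_rcMeasureW
          (delW w {e | ∃ v ∈ e, ∃ x ∈ X, (openGraph ω).Reachable x v}) hq0 ∅
        exact hub_world_eq_rc _ s X T c Sig c₀ g ω
      rw [funext e]
      exact hR g hg hg0) f hf
  rw [hub_conclusion_eq_rc (rcMeasureW w q ∅) _ s X T c Sig c₀ f] at main
  exact main

end Hub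

end Literature.Probability.Percolation

end
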